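import Summits.NavierStokesRegularity.FunctionalMining.BiaxialXRay
import HarnessLib

/-!
# FunctionalMining — the longitudinal strain vanishes somewhere in EVERY direction; the axis of a biaxial
# strain meets the magic-angle cone `3(e·n)² = |e|²` of EVERY direction `e` (fully three-dimensional axis)

Search for candidate a priori estimates; no regularity claim. Cell `pub-nsfunc`, prove seat (gen 20).
Static calculus of smooth fields on the flat torus; nothing about Navier–Stokes dynamics. Fourth file of
the eikonal-obstruction group; strengthens the closed-lattice-line statements of `BiaxialXRay`
(`exists_longitudinalStrain_eq_zero`, `exists_axis_magic_angle`) from lattice directions to ALL directions,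
by the degeneracy principle of `BiaxialEikonalObstruction` instead of Rolle:

* `exists_longitudinalStrain_eq_zero_dir`: for every smooth `v : T^d → ℝ^d` and every `K ∈ ℝ^d` there is a
  point `p` with `Kᵀ S(v)(p) K = 0` — take `p` a maximum point of the periodic function `K·v` (Fermat on the
  torus, `partialDeriv_eq_zero_of_forall_le`); there `Kᵀ S(v) K = ∑ⱼ Kⱼ ∂ⱼ(K·v) = 0`.
* `exists_axis_magic_angle_dir`: if `S(v)(y) = m(1 − 3n(y)⊗n(y))`, `m ≠ 0`, then for EVERY `K` there is a
  point with `3(K·n)² = |K|²`; for `K ≠ 0`: the axis makes exactly the angle `arccos(1/√3)` with `K`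
  somewhere — **the Gauss image of the axis of an exact periodic biaxial strain meets the magic circle of
  every direction** (`not_forall_axis_inside_cone`, `not_forall_axis_outside_cone`: it is confined neither
  inside nor outside the magic cone of any direction). A necessary condition on the fully three-dimensional
  problem of `SIEVELD.md` §3.4b (4d)/(4e) that uses no lattice structure of the direction.
[ours = assembly; folklore = Fermat]
-/

noncomputable section

open MeasureTheory Set Filter Topology

namespace Summit.NavierStokesRegularity.FunctionalMining
open Literature.Analysis Literature.Analysis.FunctionSpaces Literature.Analysis.FunctionSpaces.Torus
  Literature.Analysis.FluidPDE

namespace BiaxialEikonal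

variable {d : Type*} [Fintype d] [DecidableEq d]

/-- Partial derivatives of the component `K·v`: `∂ⱼ(∑ᵢ Kᵢvᵢ) = ∑ᵢ Kᵢ ∂ⱼvᵢ`. [folklore] -/
theorem partialDeriv_dot_const {v : UnitAddTorus d → EuclideanSpace ℝ d} (hv : Torus.IsSmooth v)
    (K : d → ℝ) (j : d) (x : UnitAddTorus d) :
    Torus.partialDeriv j (fun y => ∑ i, K i * v y i) x = ∑ i, K i * Torus.partialDeriv j v x i := by
  have hs : ∀ i, Torus.IsContDiff 1 (fun y => K i * v y i) :=
    fun i => ContDiff.mul contDiff_const ((hv.apply i).isContDiff (by simp))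
  rw [partialDeriv_finset_sum _ (fun i _ => hs i)]
  refine Finset.sum_congr rfl fun i _ => ?_
  rw [show (fun y => K i * v y i) = K i • fun y => v y i from rfl,
    partialDeriv_const_smul ((hv.apply i).isContDiff (by simp)) (K i) j, Pi.smul_apply, smul_eq_mul,
    partialDeriv_apply_coord (hv.isContDiff (by simp))]

/-- **THE LONGITUDINAL STRAIN VANISHES SOMEWHERE IN EVERY DIRECTION.** For every smooth field `v` on
`T^d` and every `K ∈ ℝ^d` there is a point `p` with `∑ᵢⱼ KᵢKⱼ S(v)(p)ᵢⱼ = 0`: at a maximum point of the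
periodic function `K·v`, `Kᵀ S(v) K = ∑ⱼ Kⱼ ∂ⱼ(K·v) = 0`. (For lattice `K` compare the Rolle version on
each closed line, `exists_longitudinalStrain_eq_zero`.) [ours; elementary] -/
theorem exists_longitudinalStrain_eq_zero_dir {v : UnitAddTorus d → EuclideanSpace ℝ d}
    (hv : Torus.IsSmooth v) (K : d → ℝ) :
    ∃ p, ∑ i, ∑ j, K i * K j * torusStrainMatrix v p i j = 0 := by
  have hcont : Continuous fun y => ∑ i, K i * v y i :=
    continuous_finsetSum _ fun i _ => continuous_const.mul (hv.apply i).continuous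
  obtain ⟨p, -, hp⟩ := exists_forall_partialDeriv_eq_zero hcont
  refine ⟨p, ?_⟩
  have hK : ∑ i, ∑ j, K i * K j * torusStrainMatrix v p i j =
      ∑ i, ∑ j, (WithLp.toLp 2 K : EuclideanSpace ℝ d) i * (WithLp.toLp 2 K : EuclideanSpace ℝ d) j *
        torusStrainMatrix v p i j := by simp
  rw [hK, ← sum_partialDeriv_eq_sum_strain, Finset.sum_comm]
  have : ∀ j, ∑ i, K i * K j * Torus.partialDeriv j v p i = K j * Torus.partialDeriv j (fun y => ∑ i, K i * v y i) p :=
    fun j => by rw [partialDeriv_dot_const hv, Finset.mul_sum]; exact Finset.sum_congr rfl fun i _ => by ring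
  simp only [this, hp, mul_zero, Finset.sum_const_zero]

/-- **THE AXIS MEETS THE MAGIC CONE OF EVERY DIRECTION.** If `S(v)(y) = m(1 − 3 n(y)⊗n(y))` with `m ≠ 0`,
then for every `K ∈ ℝ^d` there is a point `p` with `3(K·n(p))² = |K|²`. [ours] -/
theorem exists_axis_magic_angle_dir {v : UnitAddTorus d → EuclideanSpace ℝ d} (hv : Torus.IsSmooth v)
    {m : ℝ} (hm : m ≠ 0) {n : UnitAddTorus d → d → ℝ}
    (hS : ∀ y, torusStrainMatrix v y = m • (1 - (3 : ℝ) • Matrix.vecMulVec (n y) (n y))) (K : d → ℝ) :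
    ∃ p, 3 * (∑ i, K i * n p i) ^ 2 = ∑ i, K i ^ 2 := by
  obtain ⟨p, h⟩ := exists_longitudinalStrain_eq_zero_dir hv K
  refine ⟨p, ?_⟩
  rw [hS, longitudinal_biaxial] at h
  have := (mul_eq_zero.mp h).resolve_left hm
  linarith

/-- The axis is not confined INSIDE the magic cone of any direction: `¬ ∀ y, 3(K·n(y))² > |K|²`. [ours] -/
theorem not_forall_axis_inside_cone {v : UnitAddTorus d → EuclideanSpace ℝ d} (hv : Torus.IsSmooth v)
    {m : ℝ} (hm : m ≠ 0) {n : UnitAddTorus d → d → ℝ}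
    (hS : ∀ y, torusStrainMatrix v y = m • (1 - (3 : ℝ) • Matrix.vecMulVec (n y) (n y))) (K : d → ℝ) :
    ¬ ∀ y, ∑ i, K i ^ 2 < 3 * (∑ i, K i * n y i) ^ 2 := by
  intro h
  obtain ⟨p, hp⟩ := exists_axis_magic_angle_dir hv hm hS K
  exact absurd (h p) (by rw [hp]; exact lt_irrefl _)

/-- … nor OUTSIDE it: `¬ ∀ y, 3(K·n(y))² < |K|²`. For a unit `K = e`: the angle between the axis and `e`
is neither everywhere smaller nor everywhere larger than `arccos(1/√3)`. [ours] -/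
theorem not_forall_axis_outside_cone {v : UnitAddTorus d → EuclideanSpace ℝ d} (hv : Torus.IsSmooth v)
    {m : ℝ} (hm : m ≠ 0) {n : UnitAddTorus d → d → ℝ}
    (hS : ∀ y, torusStrainMatrix v y = m • (1 - (3 : ℝ) • Matrix.vecMulVec (n y) (n y))) (K : d → ℝ) :
    ¬ ∀ y, 3 * (∑ i, K i * n y i) ^ 2 < ∑ i, K i ^ 2 := by
  intro h
  obtain ⟨p, hp⟩ := exists_axis_magic_angle_dir hv hm hS K
  exact absurd (h p) (by rw [hp]; exact lt_irrefl _)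

/-- Coordinate directions: for every `j` there is a point with `3 nⱼ² = 1` (not only on each closed
`xⱼ`-circle as in `exists_axis_coord_sq_eq_third`, but this version needs no line structure). [ours] -/
theorem exists_axis_coord_sq_eq_third_dir {v : UnitAddTorus d → EuclideanSpace ℝ d}
    (hv : Torus.IsSmooth v) {m : ℝ} (hm : m ≠ 0) {n : UnitAddTorus d → d → ℝ}
    (hS : ∀ y, torusStrainMatrix v y = m • (1 - (3 : ℝ) • Matrix.vecMulVec (n y) (n y))) (j : d) :
    ∃ p, 3 * n p j ^ 2 = 1 := by
  obtain ⟨p, hp⟩ := exists_axis_magic_angle_dir hv hm hS (Pi.single j 1)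
  refine ⟨p, ?_⟩
  simpa [Pi.single_apply, Finset.sum_ite_eq', Finset.mem_univ] using hp

/-! ## Variable modulus: the same conclusions for `S(v)(y) = m(y)(1 − 3 n(y)⊗n(y))`, `m(y) ≠ 0` -/

/-- **MAGIC CONE OF EVERY DIRECTION, VARIABLE MODULUS.** If `S(v)(y) = m(y)·(1 − 3 n(y)⊗n(y))` at every
point, with a modulus `m(y) ≠ 0` and a unit axis `n(y)` that may both vary from point to point (the
"biaxial at every point" class of `SIEVELD.md` §3.4b (4h), fully three-dimensional, NO
constancy of the modulus), then for every `K ∈ ℝ^d` there is a point with `3(K·n)² = |K|²`: at the point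
`p` where `Kᵀ S(v)(p) K = 0` one has `m(p)(|K|² − 3(K·n(p))²) = 0` and `m(p) ≠ 0`. [ours] -/
theorem exists_axis_magic_angle_var {v : UnitAddTorus d → EuclideanSpace ℝ d} (hv : Torus.IsSmooth v)
    {m : UnitAddTorus d → ℝ} (hm : ∀ y, m y ≠ 0) {n : UnitAddTorus d → d → ℝ}
    (hS : ∀ y, torusStrainMatrix v y = m y • (1 - (3 : ℝ) • Matrix.vecMulVec (n y) (n y))) (K : d → ℝ) :
    ∃ p, 3 * (∑ i, K i * n p i) ^ 2 = ∑ i, K i ^ 2 := by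
  obtain ⟨p, h⟩ := exists_longitudinalStrain_eq_zero_dir hv K
  refine ⟨p, ?_⟩
  rw [hS, longitudinal_biaxial] at h
  have := (mul_eq_zero.mp h).resolve_left (hm p)
  linarith

/-- Variable modulus: the axis is not confined inside the magic cone of any direction. [ours] -/
theorem not_forall_axis_inside_cone_var {v : UnitAddTorus d → EuclideanSpace ℝ d} (hv : Torus.IsSmooth v)
    {m : UnitAddTorus d → ℝ} (hm : ∀ y, m y ≠ 0) {n : UnitAddTorus d → d → ℝ}
    (hS : ∀ y, torusStrainMatrix v y = m y • (1 - (3 : ℝ) • Matrix.vecMulVec (n y) (n y))) (K : d → ℝ) :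
    ¬ ∀ y, ∑ i, K i ^ 2 < 3 * (∑ i, K i * n y i) ^ 2 := by
  intro h
  obtain ⟨p, hp⟩ := exists_axis_magic_angle_var hv hm hS K
  exact absurd (h p) (by rw [hp]; exact lt_irrefl _)

/-- Variable modulus: … nor outside it. [ours] -/
theorem not_forall_axis_outside_cone_var {v : UnitAddTorus d → EuclideanSpace ℝ d} (hv : Torus.IsSmooth v)
    {m : UnitAddTorus d → ℝ} (hm : ∀ y, m y ≠ 0) {n : UnitAddTorus d → d → ℝ}
    (hS : ∀ y, torusStrainMatrix v y = m y • (1 - (3 : ℝ) • Matrix.vecMulVec (n y) (n y))) (K : d → ℝ) :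
    ¬ ∀ y, 3 * (∑ i, K i * n y i) ^ 2 < ∑ i, K i ^ 2 := by
  intro h
  obtain ⟨p, hp⟩ := exists_axis_magic_angle_var hv hm hS K
  exact absurd (h p) (by rw [hp]; exact lt_irrefl _)

/-- Variable modulus, coordinate directions: for every `j` a point with `3 nⱼ² = 1`. [ours] -/
theorem exists_axis_coord_sq_eq_third_var {v : UnitAddTorus d → EuclideanSpace ℝ d}
    (hv : Torus.IsSmooth v) {m : UnitAddTorus d → ℝ} (hm : ∀ y, m y ≠ 0) {n : UnitAddTorus d → d → ℝ}
    (hS : ∀ y, torusStrainMatrix v y = m y • (1 - (3 : ℝ) • Matrix.vecMulVec (n y) (n y))) (j : d) :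
    ∃ p, 3 * n p j ^ 2 = 1 := by
  obtain ⟨p, hp⟩ := exists_axis_magic_angle_var hv hm hS (Pi.single j 1)
  refine ⟨p, ?_⟩
  simpa [Pi.single_apply, Finset.sum_ite_eq', Finset.mem_univ] using hp

/-- Variable modulus, closed lattice lines (the Rolle version of `BiaxialXRay`): on every closed lattice
line `t ↦ x + tk` there is a point with `3(k·n)² = |k|²`. [ours] -/
theorem exists_axis_magic_angle_line_var {v : UnitAddTorus d → EuclideanSpace ℝ d} (hv : Torus.IsSmooth v)
    {m : UnitAddTorus d → ℝ} (hm : ∀ y, m y ≠ 0) {n : UnitAddTorus d → d → ℝ}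
    (hS : ∀ y, torusStrainMatrix v y = m y • (1 - (3 : ℝ) • Matrix.vecMulVec (n y) (n y)))
    (k : d → ℤ) (x : UnitAddTorus d) :
    ∃ t ∈ Ioo (0 : ℝ) 1, 3 * (∑ i, (latticeVec k) i * n (x + proj (t • latticeVec k)) i) ^ 2 =
      ∑ i, (latticeVec k) i ^ 2 := by
  obtain ⟨t, ht, h⟩ := exists_longitudinalStrain_eq_zero hv k x
  refine ⟨t, ht, ?_⟩
  rw [hS, longitudinal_biaxial] at h
  have := (mul_eq_zero.mp h).resolve_left (hm _)
  linarith

end BiaxialEikonal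

end Summit.NavierStokesRegularity.FunctionalMining

end
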